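import Literature.AlgebraicGeometry.AbelianSchemes.AbelianSchemeSteinOfArtinian
import Literature.AlgebraicGeometry.Morphisms.RigidityLemmaStein
import HarnessLib

/-!
# Rigidity inputs for a smooth proper lift of an abelian scheme over an Artin base
# ([MumfordFogartyKirwan1994] Ch. 6 §3 Prop. 6.15 — setting, and the two tools of its second half)

Topic `Literature/AlgebraicGeometry/AbelianSchemes`; namespace
`Literature.AlgebraicGeometry.AbelianSchemes.AbelianSchemeOver.LiftedLaw`.  THEOREMS ONLY (no definition, no named fact, no
instance, no notation, no `sorry`; net Literature debt 0).  Cell hodgecm-mathlib (D-0151), F-DAG row F-11 (A4b) = F-4 sub-stub II-a,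
ONE OWNER B-p04 lineage; HOME-only capital, FILE B1 of 2 (FILE B2 = `AbelianSchemeOfLiftedGroupLaw`).  HC_CM is proved only modulo
the 7 printed citations until rung 0 closes; this file discharges none of them.

SETTING of [MumfordFogartyKirwan1994, Ch. 6 §3 Prop. 6.15 (p. 124)]: `A` an Artin local ring, `J ⊆ A` a proper (hence nilpotent)
ideal, `X → Spec A` proper smooth, `A₀` an abelian scheme over `Spec (A⧸J)` with a cartesian square `G : A₀.X → X` over
`Spec (A⧸J) → Spec A`.  This file supplies, def-free:

* §1 `T`-POINT ALGEBRA in a cartesian monoidal category: left division `a∖c := pr₂ (pr₁, m)⁻¹ (a, c)` (`mul_ldiv`); **associativity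
  of a law `m` from the two rigidity outputs** «`x∖x` constant» and «`((xy)z)∖(x(yz))` constant» (`assoc_of_defects`); the shears of a
  group object are isomorphisms and `pr₂ (pr₁, μ)⁻¹ (x, y) = x⁻¹ y` (`isIso_shearLeft`, `isIso_shearRight`, `lift_inv_shearLeft_snd`);
* §2 COMPARISON along `i : S₀ → S`: products of cartesian squares are cartesian (`isPullback_tensor`, adapted from ★
  `RelativeSpec.isPullback_fst_comp_map`), base changes of surjections, and the calculus of morphisms `f₀ ↔ f` compatible with the
  comparison maps (`lift`, projections, `toUnit`, composition, identities, inverses);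
* §3 the SETTING: `GeometricallyConnected (X → Spec A)` (every `Spec K → Spec A` factors through `Spec (A⧸J)`;
  `geometricallyConnected_of_isPullback_specMap_mk`); the STEIN property `Γ(U, 𝒪) ⥲ Γ(p⁻¹U, 𝒪_W)` for `W → Spec A` proper smooth
  with abelian base change `W₀` (★ `Morphisms.appTop_bijective_of_isArtinianRing` + ★ `AbelianSchemeOver.app_bijective_of_isReduced`
  on the closed fibre; `app_bijective_of_isPullback_specMap_mk`); and **RIGIDITY ON THE CLOSED FIBRE** ([MFK94] Prop. 6.1 without
  reducedness, ★ `Morphisms.rigidity_of_flat_of_stein`): an `S`-morphism `u : W → Y` compatible on the `S₀`-side with a CONSTANT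
  morphism factors through the base, `t ≫ u = toUnit ≫ e ≫ u` (`comp_eq_toUnit_comp_of_compatible`).

## References
* [MumfordFogartyKirwan1994] D. Mumford, J. Fogarty, F. Kirwan, *Geometric Invariant Theory*, 3rd ed., Springer (1994), Ch. 6
  §3 Prop. 6.15 and its proof (pp. 124–125); Ch. 6 §1 Prop. 6.1 (rigidity, pp. 115–116), Def. 6.1 (p. 115); Ch. 7 §2
  Def. 7.2 (p. 129).
* [Schlessinger1968] M. Schlessinger, *Functors of Artin rings*, Trans. AMS 130 (1968), Lemma 3.3 (p. 216).
* [EdixhovenRomagny2012] B. Edixhoven, M. Romagny, *Group schemes out of birational group laws, Néron models* (2012),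
  Thm. 2.11 (2)–(5).
-/

noncomputable section

set_option backward.isDefEq.respectTransparency false

universe u

open CategoryTheory CategoryTheory.Limits AlgebraicGeometry MonoidalCategory CartesianMonoidalCategory
open scoped MonObj

namespace Literature.AlgebraicGeometry.AbelianSchemes.AbelianSchemeOver.LiftedLaw

/-! ### §1 `T`-point algebra: left division, associativity from the two rigidity outputs, shears of a group object -/

section Algebra

variable {C : Type*} [Category C] [CartesianMonoidalCategory C] {X : C}

/-- Left division `a∖c := pr₂ ((pr₁, m)⁻¹ (a, c))` solves `a · (a∖c) = c` (as in ★ `NeronModels/GroupObjectOfShearIso`).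
[cite: EdixhovenRomagny2012, Thm. 2.11] -/
theorem mul_ldiv (m : X ⊗ X ⟶ X) [IsIso (lift (fst X X) m)] {T : C} (a c : T ⟶ X) :
    lift a (lift a c ≫ inv (lift (fst X X) m) ≫ snd X X) ≫ m = c := by
  set y := lift a c ≫ inv (lift (fst X X) m) with hy
  have h : y ≫ lift (fst X X) m = lift a c := by rw [hy, Category.assoc, IsIso.inv_hom_id, Category.comp_id]
  rw [comp_lift] at h
  have h1 : y ≫ fst X X = a := by simpa using congrArg (· ≫ fst X X) h
  have h2 : y ≫ m = c := by simpa using congrArg (· ≫ snd X X) h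
  have hy' : y = lift a (y ≫ snd X X) := by
    apply CartesianMonoidalCategory.hom_ext <;> simp [h1]
  rw [← Category.assoc, ← hy, ← h2]
  exact congrArg (· ≫ m) hy'.symm

/-- **Associativity from the two rigidity outputs.**  If `x∖x` is the constant `η₁` and the associativity defect
`((xy)z)∖(x(yz))` is the constant `ηₐ` (both naturally in `T`), then `m` is associative on `T`-points: `η₁` is a right
unit, `x(yz) = ((xy)z)·ηₐ`, and `z := η₁` shows `v·ηₐ = v` for every `v = x·y`, i.e. for every `v`.
[cite: MumfordFogartyKirwan1994, Ch. 6 §3 Proposition 6.15, proof (p. 125), «these identities extend»] -/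
theorem assoc_of_defects (m : X ⊗ X ⟶ X) [IsIso (lift (fst X X) m)] (η₁ ηₐ : 𝟙_ C ⟶ X)
    (h1 : ∀ {T : C} (x : T ⟶ X), lift x x ≫ inv (lift (fst X X) m) ≫ snd X X = toUnit T ≫ η₁)
    (h2 : ∀ {T : C} (x y z : T ⟶ X),
      lift (lift (lift x y ≫ m) z ≫ m) (lift x (lift y z ≫ m) ≫ m) ≫ inv (lift (fst X X) m) ≫ snd X X = toUnit T ≫ ηₐ)
    {T : C} (x y z : T ⟶ X) : lift (lift x y ≫ m) z ≫ m = lift x (lift y z ≫ m) ≫ m := by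
  -- `η₁` is a right unit
  have hunit : ∀ {T' : C} (v : T' ⟶ X), lift v (toUnit T' ≫ η₁) ≫ m = v := fun {T'} v => by
    rw [← h1 v]; exact mul_ldiv m v v
  -- `x(yz) = ((xy)z)·ηₐ`
  have hdef : ∀ {T' : C} (x y z : T' ⟶ X),
      lift (lift (lift x y ≫ m) z ≫ m) (toUnit T' ≫ ηₐ) ≫ m = lift x (lift y z ≫ m) ≫ m := fun {T'} x y z => by
    rw [← h2 x y z]; exact mul_ldiv m _ _
  -- `ηₐ` is a right unit: put `z := η₁`, then every `v` is of the form `v · η₁`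
  have hunit' : ∀ {T' : C} (v : T' ⟶ X), lift v (toUnit T' ≫ ηₐ) ≫ m = v := fun {T'} v => by
    have h := hdef v (toUnit T' ≫ η₁) (toUnit T' ≫ η₁)
    simp only [hunit] at h
    exact h
  rw [← hdef x y z, hunit']

variable {B : C} [GrpObj B]

/-- In a group object the left shear `(pr₁, μ)` is an isomorphism, with inverse `(pr₁, pr₁⁻¹·pr₂)`.
[cite: MumfordFogartyKirwan1994, Ch. 6 §1 Definition 6.1 (p. 115)] -/
theorem isIso_shearLeft : IsIso (lift (fst B B) μ[B]) := by
  refine ⟨⟨lift (fst B B) ((fst B B)⁻¹ * snd B B), ?_, ?_⟩⟩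
  · rw [comp_lift, lift_fst, MonObj.comp_mul, GrpObj.comp_inv, lift_fst, lift_snd, MonObj.mul_eq_mul,
      inv_mul_cancel_left]
    exact lift_fst_snd
  · rw [comp_lift, lift_fst]
    have : lift (fst B B) ((fst B B)⁻¹ * snd B B) ≫ μ[B] = snd B B := by
      rw [MonObj.mul_eq_mul, MonObj.comp_mul, lift_fst, lift_snd, mul_inv_cancel_left]
    rw [this]
    exact lift_fst_snd

/-- In a group object the right shear `(μ, pr₂)` is an isomorphism, with inverse `(pr₁·pr₂⁻¹, pr₂)`.
[cite: MumfordFogartyKirwan1994, Ch. 6 §1 Definition 6.1 (p. 115)] -/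
theorem isIso_shearRight : IsIso (lift μ[B] (snd B B)) := by
  refine ⟨⟨lift (fst B B * (snd B B)⁻¹) (snd B B), ?_, ?_⟩⟩
  · rw [comp_lift, lift_snd, MonObj.comp_mul, GrpObj.comp_inv, lift_fst, lift_snd, MonObj.mul_eq_mul,
      mul_inv_cancel_right]
    exact lift_fst_snd
  · rw [comp_lift, lift_snd]
    have : lift (fst B B * (snd B B)⁻¹) (snd B B) ≫ μ[B] = fst B B := by
      rw [MonObj.mul_eq_mul, MonObj.comp_mul, lift_fst, lift_snd, inv_mul_cancel_right]
    rw [this]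
    exact lift_fst_snd

/-- In a group object `pr₂ ((pr₁, μ)⁻¹ (x, y)) = x⁻¹·y`. [cite: MumfordFogartyKirwan1994, Ch. 6 §1 Definition 6.1 (p. 115)] -/
theorem lift_inv_shearLeft_snd [IsIso (lift (fst B B) μ[B])] {T : C} (x y : T ⟶ B) :
    lift x y ≫ inv (lift (fst B B) μ[B]) ≫ snd B B = x⁻¹ * y := by
  have h : lift x (x⁻¹ * y) ≫ lift (fst B B) μ[B] = lift x y := by
    rw [comp_lift, lift_fst, ← Hom.mul_def, mul_inv_cancel_left]
  rw [← h, Category.assoc, IsIso.hom_inv_id_assoc, lift_snd]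

end Algebra

/-! ### §2 Comparison along the base change `S₀ → S`: products of cartesian squares, compatible morphisms -/

section Comparison

variable {S₀ S : Scheme.{u}} {i : S₀ ⟶ S}

/-- Products of cartesian squares over `i : S₀ → S` are cartesian: if `c_Y : Y₀ → Y` and `c_Z : Z₀ → Z` exhibit `Y₀`,
`Z₀` as the base changes of `Y`, `Z` along `i`, then `c_Y × c_Z : Y₀ ×_{S₀} Z₀ → Y ×_S Z` exhibits the base change of the
product (adapted from ★ `RelativeSpec.isPullback_fst_comp_map`). [cite: MumfordFogartyKirwan1994, Ch. 7 §2 Definition 7.2 (p. 129)] -/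
theorem isPullback_tensor {Y₀ Z₀ : Over S₀} {Y Z : Over S} {cY : Y₀.left ⟶ Y.left} {cZ : Z₀.left ⟶ Z.left}
    (hY : IsPullback cY Y₀.hom Y.hom i) (hZ : IsPullback cZ Z₀.hom Z.hom i) :
    IsPullback (pullback.map Y₀.hom Z₀.hom Y.hom Z.hom cY cZ i hY.w.symm hZ.w.symm) (Y₀ ⊗ Z₀).hom (Y ⊗ Z).hom i := by
  have hO : IsPullback (pullback.snd Y₀.hom Z₀.hom ≫ cZ) (pullback.fst Y₀.hom Z₀.hom) Z.hom (cY ≫ Y.hom) := by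
    rw [hY.w]
    exact (IsPullback.of_hasPullback Y₀.hom Z₀.hom).flip.paste_horiz hZ
  have hT : IsPullback (pullback.map Y₀.hom Z₀.hom Y.hom Z.hom cY cZ i hY.w.symm hZ.w.symm) (pullback.fst Y₀.hom Z₀.hom)
      (pullback.fst Y.hom Z.hom) cY := by
    refine IsPullback.of_right ?_ (pullback.lift_fst _ _ _) (IsPullback.of_hasPullback Y.hom Z.hom).flip
    rw [pullback.lift_snd]
    exact hO
  exact hT.paste_vert hY

/-- A base change of a surjective morphism is surjective. [cite: MumfordFogartyKirwan1994, Ch. 7 §2 Definition 7.2 (p. 129)] -/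
theorem surjective_of_isPullback [Surjective i] {Y₀ : Over S₀} {Y : Over S} {cY : Y₀.left ⟶ Y.left}
    (hY : IsPullback cY Y₀.hom Y.hom i) : Surjective cY :=
  MorphismProperty.of_isPullback hY.flip ‹Surjective i›

/-- Compatibility with `lift`: if `f₀ ↔ f` and `g₀ ↔ g` are compatible with the comparison maps then so are
`(f₀, g₀) ↔ (f, g)`. [cite: MumfordFogartyKirwan1994, Ch. 7 §2 Definition 7.2 (p. 129)] -/
theorem comp_lift_left {T₀ Y₀ Z₀ : Over S₀} {T Y Z : Over S} {cT : T₀.left ⟶ T.left} {cY : Y₀.left ⟶ Y.left}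
    {cZ : Z₀.left ⟶ Z.left} (hY : IsPullback cY Y₀.hom Y.hom i) (hZ : IsPullback cZ Z₀.hom Z.hom i)
    {f₀ : T₀ ⟶ Y₀} {f : T ⟶ Y} {g₀ : T₀ ⟶ Z₀} {g : T ⟶ Z}
    (hf : f₀.left ≫ cY = cT ≫ f.left) (hg : g₀.left ≫ cZ = cT ≫ g.left) :
    (lift f₀ g₀).left ≫ pullback.map Y₀.hom Z₀.hom Y.hom Z.hom cY cZ i hY.w.symm hZ.w.symm = cT ≫ (lift f g).left := by
  rw [Over.lift_left, Over.lift_left]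
  apply pullback.hom_ext
  · rw [Category.assoc, pullback.lift_fst, pullback.lift_fst_assoc, Category.assoc, pullback.lift_fst, hf]
  · rw [Category.assoc, pullback.lift_snd, pullback.lift_snd_assoc, Category.assoc, pullback.lift_snd, hg]

/-- Compatibility of the first projections. [cite: MumfordFogartyKirwan1994, Ch. 7 §2 Definition 7.2 (p. 129)] -/
theorem fst_left_comp {Y₀ Z₀ : Over S₀} {Y Z : Over S} {cY : Y₀.left ⟶ Y.left} {cZ : Z₀.left ⟶ Z.left}
    (hY : IsPullback cY Y₀.hom Y.hom i) (hZ : IsPullback cZ Z₀.hom Z.hom i) :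
    (fst Y₀ Z₀).left ≫ cY = pullback.map Y₀.hom Z₀.hom Y.hom Z.hom cY cZ i hY.w.symm hZ.w.symm ≫ (fst Y Z).left := by
  rw [Over.fst_left, Over.fst_left, pullback.lift_fst]

/-- Compatibility of the second projections. [cite: MumfordFogartyKirwan1994, Ch. 7 §2 Definition 7.2 (p. 129)] -/
theorem snd_left_comp {Y₀ Z₀ : Over S₀} {Y Z : Over S} {cY : Y₀.left ⟶ Y.left} {cZ : Z₀.left ⟶ Z.left}
    (hY : IsPullback cY Y₀.hom Y.hom i) (hZ : IsPullback cZ Z₀.hom Z.hom i) :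
    (snd Y₀ Z₀).left ≫ cZ = pullback.map Y₀.hom Z₀.hom Y.hom Z.hom cY cZ i hY.w.symm hZ.w.symm ≫ (snd Y Z).left := by
  rw [Over.snd_left, Over.snd_left, pullback.lift_snd]

/-- Compatibility of `toUnit`, the comparison map of the units being `i` itself.
[cite: MumfordFogartyKirwan1994, Ch. 7 §2 Definition 7.2 (p. 129)] -/
theorem toUnit_left_comp {Y₀ : Over S₀} {Y : Over S} {cY : Y₀.left ⟶ Y.left} (hY : IsPullback cY Y₀.hom Y.hom i) :
    (toUnit Y₀).left ≫ i = cY ≫ (toUnit Y).left := by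
  rw [Over.toUnit_left, Over.toUnit_left, hY.w]

/-- Compatibility is stable under composition. [cite: MumfordFogartyKirwan1994, Ch. 7 §2 Definition 7.2 (p. 129)] -/
theorem comp_left_comp {T₀ Y₀ Z₀ : Over S₀} {T Y Z : Over S} {cT : T₀.left ⟶ T.left} {cY : Y₀.left ⟶ Y.left}
    {cZ : Z₀.left ⟶ Z.left} {f₀ : T₀ ⟶ Y₀} {f : T ⟶ Y} {g₀ : Y₀ ⟶ Z₀} {g : Y ⟶ Z}
    (hf : f₀.left ≫ cY = cT ≫ f.left) (hg : g₀.left ≫ cZ = cY ≫ g.left) :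
    (f₀ ≫ g₀).left ≫ cZ = cT ≫ (f ≫ g).left := by
  rw [Over.comp_left, Over.comp_left, Category.assoc, hg, ← Category.assoc, hf, Category.assoc]

/-- The identities are compatible. [cite: MumfordFogartyKirwan1994, Ch. 7 §2 Definition 7.2 (p. 129)] -/
theorem id_left_comp {Y₀ : Over S₀} {Y : Over S} (cY : Y₀.left ⟶ Y.left) :
    (𝟙 Y₀ : Y₀ ⟶ Y₀).left ≫ cY = cY ≫ (𝟙 Y : Y ⟶ Y).left := by
  rw [Over.id_left, Over.id_left, Category.id_comp, Category.comp_id]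

/-- Compatibility passes to inverses. [cite: MumfordFogartyKirwan1994, Ch. 7 §2 Definition 7.2 (p. 129)] -/
theorem inv_left_comp {Y₀ Z₀ : Over S₀} {Y Z : Over S} {cY : Y₀.left ⟶ Y.left} {cZ : Z₀.left ⟶ Z.left}
    {f₀ : Y₀ ⟶ Z₀} {f : Y ⟶ Z} [IsIso f₀] [IsIso f] (hf : f₀.left ≫ cZ = cY ≫ f.left) :
    (inv f₀).left ≫ cY = cZ ≫ (inv f).left := by
  have h0 : (inv f₀).left ≫ f₀.left = 𝟙 _ := by rw [← Over.comp_left, IsIso.inv_hom_id, Over.id_left]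
  have h1 : f.left ≫ (inv f).left = 𝟙 _ := by rw [← Over.comp_left, IsIso.hom_inv_id, Over.id_left]
  calc (inv f₀).left ≫ cY = (inv f₀).left ≫ cY ≫ (f.left ≫ (inv f).left) := by rw [h1, Category.comp_id]
    _ = (inv f₀).left ≫ (f₀.left ≫ cZ) ≫ (inv f).left := by rw [hf, Category.assoc]
    _ = cZ ≫ (inv f).left := by rw [← Category.assoc, ← Category.assoc, h0, Category.id_comp]

end Comparison

/-! ### §3 The setting of Prop. 6.15: geometric connectedness, Stein property, rigidity on the closed fibre, shears -/

section Setting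

variable {A : Type u} [CommRing A] [IsArtinianRing A] [IsLocalRing A] {J : Ideal A}

/-- An Artin local ring has exactly one prime ideal. [cite: MumfordFogartyKirwan1994, Ch. 6 §3 Proposition 6.15 (p. 124), setting] -/
theorem subsingleton_spec : Subsingleton ↥(Spec (CommRingCat.of A)) :=
  ⟨fun p q => PrimeSpectrum.ext ((IsLocalRing.eq_maximalIdeal (inferInstance : p.asIdeal.IsMaximal)).trans
    (IsLocalRing.eq_maximalIdeal (inferInstance : q.asIdeal.IsMaximal)).symm)⟩

/-- The opens of the spectrum of an Artin local ring are `⊥` and `⊤`. [cite: MumfordFogartyKirwan1994, Ch. 6 §3 Proposition 6.15 (p. 124), setting] -/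
theorem opens_eq_bot_or_top (W : (Spec (CommRingCat.of A)).Opens) : W = ⊥ ∨ W = ⊤ := by
  haveI := subsingleton_spec (A := A)
  by_cases h : ∃ x, x ∈ W
  · obtain ⟨x, hx⟩ := h
    refine Or.inr (top_le_iff.mp fun y _ => ?_)
    have : y = x := Subsingleton.elim y x
    rw [this]; exact hx
  · exact Or.inl (le_bot_iff.mp fun y hy => h ⟨y, hy⟩)

/-- A proper ideal of an Artin local ring is nilpotent. [cite: Schlessinger1968, Lemma 3.3 (p. 216), setting] -/
theorem isNilpotent_of_ne_top (hJ : J ≠ ⊤) : IsNilpotent J := by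
  obtain ⟨n, hn⟩ := IsArtinianRing.isNilpotent_jacobson_bot (R := A)
  rw [IsLocalRing.jacobson_eq_maximalIdeal ⊥ bot_ne_top, Ideal.zero_eq_bot] at hn
  refine ⟨n, ?_⟩
  rw [Ideal.zero_eq_bot, ← le_bot_iff, ← hn]
  exact Ideal.pow_right_mono (IsLocalRing.le_maximalIdeal hJ) n

/-- `Spec (A⧸J) → Spec A` is surjective (`A⧸J ≠ 0`, one point downstairs). [cite: Schlessinger1968, Lemma 3.3 (p. 216), setting] -/
theorem surjective_specMap_mk (hJ : J ≠ ⊤) :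
    Surjective (Spec.map (CommRingCat.ofHom (Ideal.Quotient.mk J))) := by
  haveI := subsingleton_spec (A := A)
  haveI : Nontrivial (A ⧸ J) := Ideal.Quotient.nontrivial_iff.mpr hJ
  haveI : Nonempty ↥(Spec (CommRingCat.of (A ⧸ J))) := inferInstanceAs (Nonempty (PrimeSpectrum (A ⧸ J)))
  exact ⟨fun x => ⟨Classical.arbitrary _, Subsingleton.elim _ _⟩⟩

/-- A field-valued point of `Spec A` factors through `Spec (A⧸J)`: the kernel of `A → K` is the maximal ideal, which
contains the proper ideal `J`. [cite: MumfordFogartyKirwan1994, Ch. 6 §1 Definition 6.1 (p. 115), geometric fibres] -/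
theorem exists_eq_comp_specMap_mk (hJ : J ≠ ⊤) {K : Type u} [Field K] (y : Spec (.of K) ⟶ Spec (.of A)) :
    ∃ y₀ : Spec (.of K) ⟶ Spec (.of (A ⧸ J)), y = y₀ ≫ Spec.map (CommRingCat.ofHom (Ideal.Quotient.mk J)) := by
  let φ : CommRingCat.of A ⟶ CommRingCat.of K := Spec.preimage y
  have hker : ∀ a ∈ J, φ.hom a = 0 := fun a ha => by
    haveI hprime : (RingHom.ker φ.hom).IsPrime := RingHom.ker_isPrime φ.hom
    have hmax : (RingHom.ker φ.hom).IsMaximal := IsArtinianRing.isMaximal_of_isPrime (R := A) (RingHom.ker φ.hom)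
    have hle : J ≤ RingHom.ker φ.hom := by
      rw [IsLocalRing.eq_maximalIdeal hmax]; exact IsLocalRing.le_maximalIdeal hJ
    exact hle ha
  refine ⟨Spec.map (CommRingCat.ofHom (Ideal.Quotient.lift J φ.hom hker)), ?_⟩
  rw [← Spec.map_comp, ← Spec.map_preimage y]
  rfl

variable (hJ : J ≠ ⊤) {A₀ : AbelianSchemeOver (Spec (.of (A ⧸ J)))} {X : Over (Spec (.of A))}
  {G : A₀.X.left ⟶ X.left} (hG : IsPullback G A₀.X.hom X.hom (Spec.map (CommRingCat.ofHom (Ideal.Quotient.mk J))))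

include hJ hG in
/-- **The geometric fibres of `X → Spec A` are those of `X₀ → Spec (A⧸J)`, hence connected**: every `Spec K → Spec A`
factors through `Spec (A⧸J)`, and a cartesian square over the composite splits off a cartesian square over `Spec (A⧸J)`.
[cite: MumfordFogartyKirwan1994, Ch. 6 §1 Definition 6.1 (p. 115)] -/
theorem geometricallyConnected_of_isPullback_specMap_mk : GeometricallyConnected X.hom := by
  refine ⟨fun K _ y Z fst snd h => ?_⟩
  obtain ⟨y₀, rfl⟩ := exists_eq_comp_specMap_mk hJ y
  have hw : fst ≫ X.hom = (snd ≫ y₀) ≫ Spec.map (CommRingCat.ofHom (Ideal.Quotient.mk J)) := by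
    rw [h.w, Category.assoc]
  have h' : IsPullback (hG.lift fst (snd ≫ y₀) hw ≫ G) snd X.hom (y₀ ≫ Spec.map (CommRingCat.ofHom (Ideal.Quotient.mk J))) := by
    rw [hG.lift_fst]; exact h
  exact A₀.geometricallyConnected.1 y₀ (hG.lift fst (snd ≫ y₀) hw) snd
    (IsPullback.of_right h' (hG.lift_snd _ _ _) hG)

include hJ in
/-- **Stein property over the Artin base** for `W → Spec A` proper smooth whose base change to `Spec (A⧸J)` is (the
underlying scheme of) an abelian scheme `W₀`: `Γ(U, 𝒪) → Γ(p⁻¹U, 𝒪_W)` is bijective for every open `U` — the closed fibre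
of `W` is a fibre of `W₀` over a field, Stein by ★ `app_bijective_of_isReduced`, and ★ `appTop_bijective_of_isArtinianRing`
lifts this over the Artin base. [cite: MumfordFogartyKirwan1994, Ch. 6 §1 Proposition 6.1 (pp. 115–116), hypothesis] -/
theorem app_bijective_of_isPullback_specMap_mk (W₀ : AbelianSchemeOver (Spec (.of (A ⧸ J)))) (W : Over (Spec (.of A)))
    [IsProper W.hom] [Smooth W.hom] {cW : W₀.X.left ⟶ W.left}
    (hW : IsPullback cW W₀.X.hom W.hom (Spec.map (CommRingCat.ofHom (Ideal.Quotient.mk J))))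
    (U : (Spec (CommRingCat.of A)).Opens) : Function.Bijective (W.hom.app U) := by
  haveI := subsingleton_spec (A := A)
  rcases opens_eq_bot_or_top U with rfl | rfl
  · haveI : Subsingleton Γ(Spec (CommRingCat.of A), (⊥ : (Spec (CommRingCat.of A)).Opens)) :=
      CommRingCat.subsingleton_of_isTerminal ((Spec (CommRingCat.of A)).sheaf.isTerminalOfEqEmpty rfl)
    haveI : Subsingleton Γ(W.left, W.hom ⁻¹ᵁ (⊥ : (Spec (CommRingCat.of A)).Opens)) :=
      CommRingCat.subsingleton_of_isTerminal (W.left.sheaf.isTerminalOfEqEmpty (by simp))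
    exact ⟨fun a b _ => Subsingleton.elim a b, fun y => ⟨0, Subsingleton.elim _ _⟩⟩
  · -- the residue field and the factorisation `Spec k → Spec (A⧸J) → Spec A`
    let k := IsLocalRing.ResidueField A
    have hker : ∀ a ∈ J, algebraMap A k a = 0 := fun a ha =>
      (IsLocalRing.residue_eq_zero_iff a).2 (IsLocalRing.le_maximalIdeal hJ ha)
    let s₀ : Spec (.of k) ⟶ Spec (.of (A ⧸ J)) := Spec.map (CommRingCat.ofHom (Ideal.Quotient.lift J (algebraMap A k) hker))
    have hs : s₀ ≫ Spec.map (CommRingCat.ofHom (Ideal.Quotient.mk J)) =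
        Spec.map (CommRingCat.ofHom (algebraMap A k)) := by
      rw [← Spec.map_comp, ← CommRingCat.ofHom_comp]
      rfl
    -- the closed fibre of `W` is the `k`-fibre of the abelian scheme `W₀`
    have Hsq : IsPullback (pullback.fst W₀.X.hom s₀ ≫ cW) (pullback.snd W₀.X.hom s₀) W.hom
        (Spec.map (CommRingCat.ofHom (algebraMap A k))) := by
      rw [← hs]
      exact (IsPullback.of_hasPullback W₀.X.hom s₀).paste_horiz hW
    have hk0 : Function.Bijective (W₀.baseChange s₀).X.hom.appTop := (W₀.baseChange s₀).app_bijective_of_isReduced ⊤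
    have heq : pullback.snd W.hom (Spec.map (CommRingCat.ofHom (algebraMap A k))) =
        Hsq.isoPullback.inv ≫ (W₀.baseChange s₀).X.hom := by
      rw [baseChange_hom, Hsq.isoPullback_inv_snd]
    have hk : Function.Bijective (pullback.snd W.hom (Spec.map (CommRingCat.ofHom (algebraMap A k)))).appTop := by
      rw [heq, Scheme.Hom.comp_appTop]
      exact (ConcreteCategory.bijective_of_isIso (Hsq.isoPullback.inv.appTop)).comp hk0
    exact Morphisms.appTop_bijective_of_isArtinianRing W.hom hk

include hJ in
/-- **Rigidity on the closed fibre**: an `S`-morphism `u : W → X` (`W → Spec A` proper smooth with abelian base change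
`W₀`, `X → Spec A` separated) which on the `S₀`-side is compatible with a CONSTANT morphism `W₀ → X₀` (`toUnit ≫ c₀`) contracts
the one fibre of `W`, hence factors through the base: `t ≫ u = toUnit ≫ (e ≫ u)` for every `T`-point `t` of `W` and any
section `e` of `W` (★ `Morphisms.rigidity_of_flat_of_stein`, no reducedness).
[cite: MumfordFogartyKirwan1994, Ch. 6 §1 Proposition 6.1 (pp. 115–116)] [cite: MumfordFogartyKirwan1994, Ch. 6 §3 Proposition 6.15, proof (p. 125)] -/
theorem comp_eq_toUnit_comp_of_compatible (W₀ : AbelianSchemeOver (Spec (.of (A ⧸ J)))) (W : Over (Spec (.of A)))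
    [IsProper W.hom] [Smooth W.hom] {cW : W₀.X.left ⟶ W.left}
    (hW : IsPullback cW W₀.X.hom W.hom (Spec.map (CommRingCat.ofHom (Ideal.Quotient.mk J))))
    {Y₀ : Over (Spec (.of (A ⧸ J)))} (Y : Over (Spec (.of A))) [IsSeparated Y.hom] (cY : Y₀.left ⟶ Y.left)
    (u : W ⟶ Y) (c₀ : 𝟙_ (Over (Spec (.of (A ⧸ J)))) ⟶ Y₀) (hu : (toUnit W₀.X ≫ c₀).left ≫ cY = cW ≫ u.left)
    (e : 𝟙_ (Over (Spec (.of A))) ⟶ W) {T : Over (Spec (.of A))} (t : T ⟶ W) :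
    t ≫ u = toUnit T ≫ e ≫ u := by
  haveI := subsingleton_spec (A := A)
  haveI : PreconnectedSpace ↥(Spec (CommRingCat.of A)) := ⟨Set.subsingleton_univ.isPreconnected⟩
  haveI : Surjective (Spec.map (CommRingCat.ofHom (Ideal.Quotient.mk J))) := surjective_specMap_mk hJ
  haveI : Surjective cW := surjective_of_isPullback hW
  have hsub : Subsingleton (PrimeSpectrum (A ⧸ J)) :=
    (PrimeSpectrum.comap_injective_of_surjective (Ideal.Quotient.mk J) Ideal.Quotient.mk_surjective).subsingleton
  haveI : Subsingleton ↥((𝟙_ (Over (Spec (CommRingCat.of (A ⧸ J))))).left) := hsub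
  haveI : Nontrivial (A ⧸ J) := Ideal.Quotient.nontrivial_iff.mpr hJ
  obtain ⟨p₀⟩ : Nonempty ↥((𝟙_ (Over (Spec (CommRingCat.of (A ⧸ J))))).left) :=
    (inferInstance : Nonempty (PrimeSpectrum (A ⧸ J)))
  -- `u` contracts the (only) fibre of `W`: every point of `W` comes from `W₀`, where `u` is constant
  have h₀ : ∀ x : ↥W.left, W.hom.base x = IsLocalRing.closedPoint A → u.left.base x = (c₀.left ≫ cY).base p₀ := by
    intro x _
    obtain ⟨w₀, rfl⟩ := cW.surjective x
    have h := congrArg (fun φ => φ.base w₀) hu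
    simp only [Over.comp_left, Over.toUnit_left, Scheme.Hom.comp_base, TopCat.comp_app] at h
    rw [Scheme.Hom.comp_base, TopCat.comp_app, ← Subsingleton.elim ((toUnit W₀.X).left.base w₀) p₀, ← h]
    rfl
  have he : e.left ≫ W.hom = 𝟙 _ := Over.w e
  have hStein := app_bijective_of_isPullback_specMap_mk hJ W₀ W hW
  have key : u.left = W.hom ≫ e.left ≫ u.left :=
    Morphisms.rigidity_of_flat_of_stein u.left (Over.w u) e.left he hStein h₀
  have key' : u = toUnit W ≫ e ≫ u := by
    ext
    rw [Over.comp_left, Over.comp_left, Over.toUnit_left]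
    exact key
  conv_lhs => rw [key']
  rw [← Category.assoc, comp_toUnit]

end Setting

end Literature.AlgebraicGeometry.AbelianSchemes.AbelianSchemeOver.LiftedLaw

end
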